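import Literature.NumberTheory.ComplexMultiplication.HeckeCharacterIsogenyRational
import Literature.NumberTheory.ComplexMultiplication.FaltingsTateOfCMElliptic
import Literature.AlgebraicGeometry.Motives.FaltingsTateIsogenyInvariance
import HarnessLib

/-!
# [Faltings 1983, §5 Kor. 1] for a PAIR of CM-elliptic structures with the same Hecke character, by CM theory

Topic `Literature/NumberTheory/ComplexMultiplication`, namespace `Literature.NumberTheory.ComplexMultiplication`.
THEOREMS ONLY (no definition, no named fact, no instance; net Literature debt 0).  Cell `hodgecm-mathlib`
(D-0151), T5 banked witness: the «Hom version for two CM-elliptic structures of one type» named in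
`A-plan/FALTINGS-SPEC.md` §9, assembled from three ★ files — [Shimura1998] Lemma 19.12
(`HeckeCharacterIsogenyRational`: same Hecke character ⇒ `k`-isogenous), isogeny invariance of
`faltings_tate_bijective` (`FaltingsTateIsogenyInvariance`, [Fal83 §5] first sentence of the proof of Satz 4), and
the CM-elliptic `End` instance (`FaltingsTateOfCMElliptic`, Serre–Tate §4 Cor. 1 + Shimura–Taniyama).

For two structures `(A, ι)`, `(A′, ι′)` of the same type `(K, Φ)`, `[K : ℚ] = 2` (CM elliptic curves with CM by
`𝓞_K` defined over `k ⊇ K`), over a number field `k ⊂ ℂ`, uniformised by `ξ`, `ξ′` and determining the SAME Hecke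
character `χ` ([Shimura1998] p. 137), the Tate map `ℤ_ℓ ⊗ Hom_k(A, A′) → Hom_{Γ_k}(T_ℓ A, T_ℓ A′)` is bijective
(`Function.Bijective (faltingsTateMap A A′ ℓ)` = the body of `faltings_tate_bijective A A′ ℓ`, the TEXT of
[Fal83 §5 Kor. 1], here for a genuine PAIR) — granted
[Shimura1998, Thm. 18.6] (`shimura1998_thm18_6`, a theorem of the tree Summits-side).  No use of [Fal83].

* `bijective_faltingsTateMap_of_CM_elliptic_pair_of_thm18_6` — the statement above, as
  `Function.Bijective (faltingsTateMap A A′ ℓ)` at the ambient `NumberField k` instance (the named fact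
  `faltings_tate_bijective A A′ ℓ := ∀ [NumberField k], …` re-binds that instance; the Hecke character `χ` already
  requires it, so the unfolded form is stated to keep one instance).

## References
* [Faltings1983Endlichkeit] G. Faltings, Invent. Math. 73 (1983), §5 Korollar 1 (the statement decided).
* [Shimura1998] G. Shimura, *Abelian Varieties with Complex Multiplication and Modular Functions* (1998), §19.12
  Lemma 19.12 (p. 138); §18.6 Thm. 18.6.
* [SerreTate1968] J.-P. Serre, J. Tate, Ann. of Math. 88 (1968), §4 Thm. 5, Cor. 1.
-/

set_option autoImplicit false

noncomputable section

open scoped nonZeroDivisors NumberField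
open CategoryTheory NumberField IsDedekindDomain

namespace Literature.NumberTheory.ComplexMultiplication

open Literature.AlgebraicGeometry.Motives
open Literature.NumberTheory.GaloisRepresentations

namespace CMTypeUniformization

variable {K : Type} [Field K] [NumberField K] [NumberField.IsCMField K] {Φ : CMType K}
  {k : IntermediateField ℚ ℂ} [NumberField k]
  {𝔞 𝔟 : (FractionalIdeal (𝓞 K)⁰ K)ˣ} {A A' : AbelianVariety k} {ι : 𝓞 K →+* End A} {ι' : 𝓞 K →+* End A'}
  (ξ : CMTypeUniformization Φ 𝔞 A ι) (ξ' : CMTypeUniformization Φ 𝔟 A' ι') {τ₀ : K →+* ℂ} {χ : HeckeCharacter k}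

/-- **[Fal83 §5 Kor. 1] for a pair of CM-elliptic structures with the same Hecke character, by CM theory.**  Let
`(A, ι)` and `(A′, ι′)` be structures of type `(K, Φ)` over the number field `k ⊂ ℂ`, `[K : ℚ] = 2`, with `(A, ι)` a
realisation of `(K, Φ)` over `k` (`IsCMTypeRealisationOver`, the binder of the CM-elliptic `End` instance), uniformised
by `ξ`, `ξ′` and determining the same Hecke character `χ` (`DeterminesHeckeCharacter` for both).  Then, granted
[Shimura1998, Thm. 18.6], `ℤ_ℓ ⊗ Hom_k(A, A′) → Hom_{Γ_k}(T_ℓ A, T_ℓ A′)` is bijective for every prime `ℓ`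
(the body of `faltings_tate_bijective A A′ ℓ` at the ambient `NumberField k` instance):
`A ∼_k A′` by Lemma 19.12 (`isIsogenous_of_determinesHeckeCharacter`), the `End` case at `(A, A)` is
`faltings_tate_bijective_of_CM_elliptic_of_thm18_6`, and bijectivity depends only on the `k`-isogeny classes
(`faltings_tate_bijective_of_isIsogenous_of_self`).
[cite: Shimura1998, §19.12 Lemma 19.12, p. 138] [cite: Faltings1983Endlichkeit, §5 Korollar 1]
[cite: SerreTate1968, §4 Theorem 5 and Corollary 1] -/
theorem bijective_faltingsTateMap_of_CM_elliptic_pair_of_thm18_6 (h186 : shimura1998_thm18_6)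
    (hA : IsCMTypeRealisationOver Φ A ι) (h2 : Module.finrank ℚ K = 2)
    (h : DeterminesHeckeCharacter Φ k 𝔞 ξ τ₀ χ) (h' : DeterminesHeckeCharacter Φ k 𝔟 ξ' τ₀ χ)
    (ℓ : ℕ) [Fact ℓ.Prime] : Function.Bijective (AbelianVariety.faltingsTateMap A A' ℓ) :=
  faltings_tate_bijective_of_isIsogenous_of_self ℓ (AbelianVariety.IsIsogenous.refl A)
    (isIsogenous_of_determinesHeckeCharacter ξ ξ' h h')
    (faltings_tate_bijective_of_CM_elliptic_of_thm18_6 h186 Φ A ι hA h2 ℓ)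

end CMTypeUniformization

end Literature.NumberTheory.ComplexMultiplication

end
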